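import Literature.NumberTheory.EllipticCurves.Kobayashi2003.SignedSelmerRankBoundProofs
import Literature.NumberTheory.EllipticCurves.Kobayashi2003.SignedSelmerModuleFiniteProofs
import Literature.NumberTheory.EllipticCurves.Sprung2024.ChromaticEulerCharAssemblyProofs
import Literature.NumberTheory.EllipticCurves.IwasawaEulerCharRankZeroAssemblyProofs
import Literature.NumberTheory.EllipticCurves.IwasawaSelmerControlKernelCardProofs
import Literature.NumberTheory.EllipticCurves.IwasawaSelmerControlCokerProofs
import Literature.NumberTheory.EllipticCurves.SelmerCorankControlRatProofs
import HarnessLib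

/-!
# B. D. Kim 2013, proof of Cor. 3.15: the control diagram at `n = 0` and Greenberg's Lemma 4.2 for
# Kobayashi's `Sel^±(E/K_∞)` — the signed `Γ`-Euler characteristic in rank `0` REDUCED to the
# cokernel count `#(A^ε_0/Sel_0)` and the coinvariants `(Sel^ε_∞)_Γ` (kernel theorems)

`Proofs` file (theorems only: **no definition, no named fact**; axioms standard) in the cluster
`BDKim2013`, next to the statement file `BDKim2013/SignedCharValueRankZero.lean` (named fact
`cor315_signedCharValueRankZero`: Byoung Du Kim, *The plus/minus Selmer groups for supersingular
primes*, J. Aust. Math. Soc. **95** (2013) 189–200 [BDKim2013], Cor. 3.15 p. 199 = Thm. 1.2 p. 190: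
"Assume that `Sel_p(E/F)` is finite. Let `(f^±) ⊂ Λ` be the characteristic ideal of
`Sel^±_p(E/F_∞)^∨`. Then `|f^±(0)| ∼ |Sel_p(E/F)| ∏_v c_v`", case `F = ℚ`). It is the `±` twin, word
for word, of the tree's chromatic file `Sprung2024/ChromaticEulerCharAssemblyProofs.lean` (Sprung's
Lemmas 5.8 · 5.9 for `Sel^{♯/♭}`), written for Kobayashi's objects of `Kobayashi2003/SignedSelmer.lean`
(Def. 1.1: `Sel^ε(E/K_∞) = signedSelmerInfty W κ ε = ⋃_n im Sel^ε(E/K_n)`, the Pontryagin-dual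
hypothesis structure `SignedSelmerDualData W κ γ ε`, `conjSignedSelmerInfty`). The same port exists
SUMMITS-side, route-scoped, as `Summit.BirchSwinnertonDyer.BirchSwinnertonDyer.Theorems.SignedEC.*`
(`Theorems/ThetaPartnerAtTwoSignedControlAtTwoSignedEulerCharAssembly.lean`, crux K4 at `p = 2`, seat
`prover-bsd-wall-tp2-p3`; credit for §1's statements, which agree verbatim); Literature cannot import
Summits, and the BDKim2013 statement file's `Proofs` companion belongs here, so §1 is re-proved.

## The printed proof being transcribed (Kim, pp. 199–200, verbatim)

"From the definition of `Sel^±_p(E/F_∞)` we have the diagram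
`0 → Sel_p(E/F) → H¹(F_Σ/F, A) →ᵃ ∏ 𝒫_v` over `0 → Sel^±_p(E/F_∞)^Γ → H¹(F_Σ/F_∞, A)^Γ → (∏ 𝒫^±_w)^Γ`
[vertical maps: restriction, restriction, `∏ g_v`]. From the Hochschild–Serre spectral sequence, it
follows that the middle vertical map is an isomorphism. If `v | p`, `g_v` is injective … Since
`Sel_p(E/F)` is finite, the map `a` in the diagram above is surjective by Proposition 3.8. Thus we have
`|Sel^±_p(E/F_∞)^Γ| ∼ |Sel_p(E/F)| ∏_{v∈Σ} |ker(g_v)|`. … From [2, Lemma 4.2] we have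
`f^±(0) ∼ |Sel^±_p(E/F_∞)^Γ| / |Sel^±_p(E/F_∞)_Γ| = |Sel^±_p(E/F_∞)^Γ|`. (The last equality is from
Theorem 3.14.)" ([2] = Greenberg, LNM 1716.)

## What this file PROVES (every number field `K`, `ℤ_p`-extension `κ` with topological generator `γ`,
## sign `ε`, datum `D`; then `K = ℚ`)

Write `h_0 = W.layerToInfty κ 0 : H¹(K, E[p^∞]) → H¹(K_∞, E[p^∞])`, `Sel_0 = W.selmerLayer κ 0`
(`= Sel_{p^∞}(E/K)`), `A^ε_0 = h_0⁻¹(Sel^ε(E/K_∞)) = (signedSelmerInfty W κ ε).comap h_0` — the tree's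
rendering of the cokernel of the left vertical map of Kim's diagram: "`ker g` IS `A_0/Sel_0`", exactly
as `WeierstrassCurve.KerG` (`IwasawaSelmerControlExactCountProofs`) and as the chromatic files.

* §1 (the left column of the diagram, Greenberg's Lemmas 3.2 / 4.3 shape): `Sel_0 ≤ A^ε_0` (the tree's
  `Kobayashi2003.signedSelmerLayer_zero_eq`: `Sel^ε(E/K_0) = Sel(E/K_0)`, Kobayashi's
  `E^±(F_{0,p}) = E(ℚ_p)`); **`#A^ε_0 = #Sel^ε_∞^{Γ_K} · #ker h_0`** (`h_0 : A^ε_0 → Sel^ε_∞ ∩ H¹(K_∞)^{Γ_K}`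
  is onto by Greenberg's Lemma 3.2 = tree `ZpExtension.mem_range_resOfLe_of_conjH1_eq`); hence
  **`#Sel^ε_∞^γ · #ker h_0 = #Sel_0 · #(A^ε_0/Sel_0)`** and, when `E(K_∞)[p^∞]` is finite
  (`#ker h_0 = #E[p^∞]^{Γ_K}`, tree `natCard_ker_layerToInfty_eq_natCard_fixedPoints`),
  `#Sel^ε_∞^γ · #E[p^∞]^{Γ_K} = #Sel_{p^∞}(E/K) · #(A^ε_0/Sel_0)`; finiteness transfers.
* §2 (Greenberg's Lemma 4.2 "[2, Lemma 4.2]" for the dual pair `D.isDualPair`, tree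
  `IsDualPair.constantCoeff_charGenerator_mul_natCard_endCoinvariants`, multiplied with §1):
  **`f(0) · #(Sel^ε_∞)_γ · #E[p^∞]^{Γ_K} = u · #Sel_{p^∞}(E/K) · #(A^ε_0/Sel_0)`**, `u ∈ ℤ_pˣ`.
* §3 (over `ℚ`, `p ≠ 2` good supersingular): `#E[p^∞]^{Γ_ℚ} = 1` (tree
  `Sprung2024.natCard_fixedPoints_geomPrimaryTorsion_eq_one_of_supersingular`), `E(ℚ_∞)[p^∞]` finite
  (tree `finite_fixedPoints_kerSubgroup_geomPrimaryTorsion_rat`), whence for every datum `D` with `X^ε`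
  torsion and `char X^ε = (f)`, IF `Sel_{p^∞}(E/ℚ)` and `A^ε_0/Sel_0` are finite THEN
  **`f(0) · #(Sel^ε_∞)_γ = u · #Sel_{p^∞}(E/ℚ) · #(A^ε_0/Sel_0)`**
  (`constantCoeff_charGenerator_mul_natCard_signedEndCoinvariants_rat`).

WHAT REMAINS for Cor. 3.15 (`f(0) = u · p^{ord_p ∏ c_v} · #Sel_{p^∞}(E/ℚ)`) is exactly the rest of the
printed proof: the count `#(A^ε_0/Sel_0) = ∏_v |ker g_v| = p^{ord_p ∏ c_v}` ("`a` is surjective by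
Proposition 3.8" = Cassels–Poitou–Tate; "`g_v` is injective" for `v ∣ p`, Kobayashi's (9.33);
"`|ker(g_v)| ∼ c_v`" for `v ∤ p`, Greenberg's Lemma 3.3 and p. 88) and Theorem 3.14
(`Sel^±_p(E/F_∞)_Γ = 0`). Neither is in the tree; they are vendored by the sibling statement file and
composed in `BDKim2013/SignedCharValueRankZeroProofs.lean`.

HONEST FRAMING (LADDER-BSD D-0154 (2) INPUTS, seat `bsd-inputs-kim315-p1`; item
stmt-BirchSwinnertonDyer-19288 = the fact `cor315_…` BY NAME, routes SignedLowerHalves / PrintX6 /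
SignedBaseChange): kernel theorems about the tree's transcription of Kobayashi's objects; nothing about
any curve is asserted; no `_holds`; BSD is not proved by any of this.

## References
* [BDKim2013] B. D. Kim, J. Aust. Math. Soc. 95 (2013): proof of Cor. 3.15 (pp. 199–200), Thm. 3.14
  (p. 198), Def. 3.1 (p. 193).
* [GreenbergLNM1716] R. Greenberg, LNM 1716 (1999), §3 Lemma 3.2 (p. 86), §4 Lemma 4.2 (p. 102),
  Lemma 4.3 (p. 103).
* [Kobayashi2003] S. Kobayashi, Invent. Math. 152 (2003), Def. 1.1 (p. 2), §9 (pp. 25–27).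
* [Sprung2024] F. Sprung, Adv. Math. 449 (2024) 109741, §5.2 Lemmas 5.8, 5.9 (the ♯/♭ twin).

## Design
Theorems only; `noncomputable section`; `open scoped Classical`; one universe `u`; namespace
`Literature.NumberTheory.EllipticCurves.BDKim2013`, the datum `D : Kobayashi2003.SignedSelmerDualData`
taken as an explicit argument (no dot-notation into the sibling cluster). `A^ε_0/Sel_0` is written out as
the quotient type `↥A^ε_0 ⧸ (W.selmerLayer κ 0).addSubgroupOf A^ε_0` (no abbreviation is introduced).
-/

noncomputable section

open scoped Classical NumberField

open NumberField IsDedekindDomain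

universe u

namespace Literature.NumberTheory.EllipticCurves.BDKim2013

open Literature.NumberTheory.EllipticCurves Literature.NumberTheory.EllipticCurves.IwasawaAlgebra
  Literature.NumberTheory.EllipticCurves.IwasawaDual WeierstrassCurve ZpExtension
  Literature.NumberTheory.EllipticCurves.Kobayashi2003

/-! ## §1 The control column at `n = 0`: `#Sel^ε(E/K_∞)^{Γ_K} · #ker h_0 = #Sel_0 · #(A^ε_0/Sel_0)` -/

section General

variable {K : Type u} [Field K] [NumberField K] (W : WeierstrassCurve K) {p : ℕ} [Fact p.Prime]
  (κ : ZpExtension K p) (ε : ℤˣ)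

/-- **`Sel_0 ≤ A^ε_0`**: the restriction `h_0` maps `Sel_{p^∞}(E/K_0)` into `Sel^ε(E/K_∞)` — at the
bottom layer the signed Selmer group IS the classical one (`Kobayashi2003.signedSelmerLayer_zero_eq`,
Kobayashi's "`E^±(F_{0,p}) = E(ℚ_p)`"), and `h_0(Sel^ε(E/K_0)) ⊆ Sel^ε(E/K_∞) = ⋃_n h_n(Sel^ε(E/K_n))`
by definition (`map_layerToInfty_signedSelmerLayer_le`). This is the left vertical map of Kim's
diagram (p. 199). [cite: BDKim2013, proof of Cor. 3.15 (p. 199)] [cite: Kobayashi2003, Def. 1.1 (p. 2)] -/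
theorem selmerLayer_zero_le_comap_layerToInfty_signedSelmerInfty :
    W.selmerLayer κ 0 ≤ (signedSelmerInfty W κ ε).comap (W.layerToInfty κ 0) := by
  intro y hy
  rw [AddSubgroup.mem_comap]
  refine map_layerToInfty_signedSelmerLayer_le W κ ε 0 ⟨y, ?_, rfl⟩
  rw [signedSelmerLayer_zero_eq]
  exact hy

/-- `A^ε_0 ≤ A_0 = h_0⁻¹(Sel_{p^∞}(E/K_∞))` (`Sel^ε_∞ ≤ Sel_∞`, `signedSelmerInfty_le_selmerInfty`):
the signed cokernel `A^ε_0/Sel_0` sits inside Greenberg's `ker g_0 = A_0/Sel_0`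
(`WeierstrassCurve.selmerInftyPreimage`). [cite: Kobayashi2003, Def. 1.1 (p. 2)]
[cite: GreenbergLNM1716, §3 p. 85] -/
theorem comap_layerToInfty_signedSelmerInfty_le_selmerInftyPreimage :
    (signedSelmerInfty W κ ε).comap (W.layerToInfty κ 0) ≤ W.selmerInftyPreimage κ 0 :=
  AddSubgroup.comap_mono (signedSelmerInfty_le_selmerInfty W κ ε)

/-- `s ∈ Sel^ε(E/K_∞)^γ = ker(conj_γ − 1)` iff `conj_γ s = s` in `H¹(K_∞, E[p^∞])`.
[cite: Kobayashi2003, Def. 1.1 (sentence following it, p. 2)] -/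
theorem mem_endInvariants_conjSignedSelmerInfty_iff (γ : Field.absoluteGaloisGroup K)
    (s : signedSelmerInfty W κ ε) :
    s ∈ endInvariants (conjSignedSelmerInfty W κ ε γ - 1) ↔
      W.conjH1 p κ.kerSubgroup γ (s : W.subgroupH1 p κ.kerSubgroup) = s := by
  rw [mem_endInvariants_iff, End_sub_apply, AddMonoid.End.one_apply, sub_eq_zero,
    ← coe_conjSignedSelmerInfty_apply]
  exact ⟨fun h ↦ congrArg Subtype.val h, fun h ↦ Subtype.ext h⟩

/-- **`#A^ε_0 = #Sel^ε(E/K_∞)^{Γ_K} · #ker h_0`** for `A^ε_0 = h_0⁻¹(Sel^ε(E/K_∞))`: the restriction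
`h_0` maps `A^ε_0` ONTO `Sel^ε_∞ ⊓ H¹(K_∞, E[p^∞])^{Γ_K}` (into: `range_layerToInfty_le_layerInvariants`;
onto: Greenberg's Lemma 3.2 "`Coker(h_0) = 0`" in the cocycle form
`ZpExtension.mem_range_resOfLe_of_conjH1_eq`, valid for every `ℤ_p`-extension — Kim: "the middle
vertical map is an isomorphism" needs `E(F_∞)[p^∞] = 0`; the count here needs nothing) with kernel
`ker h_0 ⊆ A^ε_0`. An identity of `Nat.card`s, no finiteness needed.
[cite: GreenbergLNM1716, §3 Lemma 3.2 (p. 86) and §4 Lemma 4.3 (p. 103)]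
[cite: BDKim2013, proof of Cor. 3.15 (p. 199)] -/
theorem natCard_comap_layerToInfty_signedSelmerInfty :
    Nat.card ↥((signedSelmerInfty W κ ε).comap (W.layerToInfty κ 0)) =
      Nat.card ↥(signedSelmerInfty W κ ε ⊓ W.layerInvariants κ 0) *
        Nat.card (W.layerToInfty κ 0).ker := by
  -- the restriction `θ : A^ε_0 → Sel^ε_∞ ⊓ H¹(K_∞)^{Γ_K}`, `y ↦ h_0 y`
  let θ : ↥((signedSelmerInfty W κ ε).comap (W.layerToInfty κ 0)) →+
      ↥(signedSelmerInfty W κ ε ⊓ W.layerInvariants κ 0) :=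
    ((W.layerToInfty κ 0).comp
      ((signedSelmerInfty W κ ε).comap (W.layerToInfty κ 0)).subtype).codRestrict
      (signedSelmerInfty W κ ε ⊓ W.layerInvariants κ 0) fun y ↦
      ⟨AddSubgroup.mem_comap.mp y.2,
        W.range_layerToInfty_le_layerInvariants_holds κ 0
          ⟨(y : W.subgroupH1 p (κ.layerSubgroup 0)), rfl⟩⟩
  have hθ : ∀ y : ↥((signedSelmerInfty W κ ε).comap (W.layerToInfty κ 0)),
      ((θ y : ↥(signedSelmerInfty W κ ε ⊓ W.layerInvariants κ 0)) : W.subgroupH1 p κ.kerSubgroup) =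
        W.layerToInfty κ 0 (y : W.subgroupH1 p (κ.layerSubgroup 0)) := fun _ ↦ rfl
  -- `θ` is onto (Greenberg's Lemma 3.2 at `n = 0`)
  have hsurj : Function.Surjective θ := by
    rintro ⟨x, hxS, hxI⟩
    obtain ⟨γ₀, hγ₀⟩ := κ.surjective (Multiplicative.ofAdd 1)
    have hγ₀' : κ.IsTopGenerator γ₀ := hγ₀
    have hfix := (W.mem_layerInvariants_iff κ 0 x).mp hxI _ (κ.pow_mem_layerSubgroup hγ₀' 0)
    have hprim : ∀ m : W.geomPrimaryTorsion p, ∃ k : ℕ, p ^ k • m = 0 := fun m ↦ by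
      obtain ⟨k, hk⟩ := m.2
      exact ⟨k, Subtype.ext (by rw [AddSubgroupClass.coe_nsmul, hk, ZeroMemClass.coe_zero])⟩
    obtain ⟨y, hy⟩ := ZpExtension.mem_range_resOfLe_of_conjH1_eq κ hγ₀' 0
      (W.continuous_smul_geomPrimaryTorsion p) hprim x hfix
    have hy' : W.layerToInfty κ 0 y = x := hy
    have hyA : y ∈ (signedSelmerInfty W κ ε).comap (W.layerToInfty κ 0) := by
      rw [AddSubgroup.mem_comap, hy']
      exact hxS
    exact ⟨⟨y, hyA⟩, Subtype.ext ((hθ ⟨y, hyA⟩).trans hy')⟩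
  -- `ker θ ≅ ker h_0` (`ker h_0 ⊆ A^ε_0`)
  have hkerle : (W.layerToInfty κ 0).ker ≤
      (signedSelmerInfty W κ ε).comap (W.layerToInfty κ 0) := fun y hy ↦ by
    rw [AddSubgroup.mem_comap, (AddMonoidHom.mem_ker).mp hy]
    exact zero_mem _
  have hker : θ.ker = ((W.layerToInfty κ 0).ker).addSubgroupOf
      ((signedSelmerInfty W κ ε).comap (W.layerToInfty κ 0)) := by
    ext y
    rw [AddMonoidHom.mem_ker, AddSubgroup.mem_addSubgroupOf, AddMonoidHom.mem_ker, ← hθ]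
    constructor
    · intro h
      rw [h]
      rfl
    · intro h
      exact Subtype.ext h
  rw [AddSubgroup.card_eq_card_quotient_mul_card_addSubgroup θ.ker,
    Nat.card_congr (QuotientAddGroup.quotientKerEquivOfSurjective θ hsurj).toEquiv, hker,
    Nat.card_congr (AddSubgroup.addSubgroupOfEquivOfLe hkerle).toEquiv]

/-- **`#Sel^ε(E/K_∞)^{Γ_K} · #ker h_0 = #Sel_0 · #(A^ε_0/Sel_0)`** — Greenberg's Lemma 4.3 with
`Sel ↦ Sel^ε` before the substitution `|ker h_0| = |E(K)_p|`, i.e. Kim's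
"`|Sel^±_p(E/F_∞)^Γ| ∼ |Sel_p(E/F)| · (order of the cokernel)`" read on the left column of the diagram
(p. 199) — for every number field, `ℤ_p`-extension and sign: both sides equal `#A^ε_0`
(`natCard_comap_layerToInfty_signedSelmerInfty` and `#A^ε_0 = #(A^ε_0/Sel_0) · #Sel_0`, using
`Sel_0 ≤ A^ε_0`). [cite: BDKim2013, proof of Cor. 3.15 (p. 199)]
[cite: GreenbergLNM1716, §4 Lemma 4.3 (p. 103)] -/
theorem natCard_signedSelmerInvariants_mul_natCard_ker_layerToInfty :
    Nat.card ↥(signedSelmerInfty W κ ε ⊓ W.layerInvariants κ 0) *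
        Nat.card (W.layerToInfty κ 0).ker =
      Nat.card ↥(W.selmerLayer κ 0) *
        Nat.card (↥((signedSelmerInfty W κ ε).comap (W.layerToInfty κ 0)) ⧸
          (W.selmerLayer κ 0).addSubgroupOf
            ((signedSelmerInfty W κ ε).comap (W.layerToInfty κ 0))) := by
  rw [← natCard_comap_layerToInfty_signedSelmerInfty W κ ε,
    AddSubgroup.card_eq_card_quotient_mul_card_addSubgroup ((W.selmerLayer κ 0).addSubgroupOf
      ((signedSelmerInfty W κ ε).comap (W.layerToInfty κ 0))),
    Nat.card_congr (AddSubgroup.addSubgroupOfEquivOfLe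
      (selmerLayer_zero_le_comap_layerToInfty_signedSelmerInfty W κ ε)).toEquiv, mul_comm]

/-- **`#Sel^ε(E/K_∞)^{Γ_K} = #Sel^ε(E/K_∞)^γ`** for a topological generator `γ`: the invariants of the
control diagram at level `0` (`Sel^ε_∞ ⊓ layerInvariants 0`) and the `γ`-invariants
`endInvariants (conj_γ − 1)` of the Euler-characteristic files have the same elements (a class fixed
by `conj_γ` is fixed by `Γ_K`, `mem_layerInvariants_zero_of_conjH1_eq`) — the `±` twin of
`WeierstrassCurve.natCard_selmerInfty_inf_layerInvariants_zero_eq`. Kim's `Λ = ℤ_p[[Gal(F_∞/F)]]`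
"identified with `ℤ_p[[X]]` by choosing a topological generator `γ`" (p. 189).
[cite: GreenbergLNM1716, §1 p. 60 and §3 p. 86] [cite: BDKim2013, §1 p. 189] -/
theorem natCard_signedSelmerInfty_inf_layerInvariants_zero_eq {γ : Field.absoluteGaloisGroup K}
    (hγ : κ.IsTopGenerator γ) :
    Nat.card ↥(signedSelmerInfty W κ ε ⊓ W.layerInvariants κ 0) =
      Nat.card ↥(endInvariants (conjSignedSelmerInfty W κ ε γ - 1)) :=
  Nat.card_congr
    { toFun := fun x ↦ ⟨⟨(x : W.subgroupH1 p κ.kerSubgroup), x.2.1⟩,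
        (mem_endInvariants_conjSignedSelmerInfty_iff W κ ε γ _).mpr
          (W.conjH1_eq_of_mem_layerInvariants_zero κ γ x.2.2)⟩
      invFun := fun s ↦ ⟨((s : signedSelmerInfty W κ ε) : W.subgroupH1 p κ.kerSubgroup),
        ⟨(s : signedSelmerInfty W κ ε).2,
          W.mem_layerInvariants_zero_of_conjH1_eq κ hγ
            ((mem_endInvariants_conjSignedSelmerInfty_iff W κ ε γ _).mp s.2)⟩⟩
      left_inv := fun _ ↦ rfl
      right_inv := fun _ ↦ rfl }

/-- **`#Sel^ε(E/K_∞)^γ · #E[p^∞]^{Γ_K} = #Sel_{p^∞}(E/K) · #(A^ε_0/Sel_0)`** (Greenberg's Lemma 4.3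
with `Sel ↦ Sel^ε`, the printed shape: "`|Sel_E(F_∞)_p^Γ| = |Sel_E(F)_p| |ker(g)| / |E(F)_p|`") —
for every number field, `ℤ_p`-extension with topological generator `γ` and sign, provided `E(K_∞)[p^∞]`
is finite (then `#ker h_0 = #E[p^∞]^{Γ_K}`, tree `natCard_ker_layerToInfty_eq_natCard_fixedPoints`).
Over `ℚ` at a supersingular `p` both correction factors are `1` and this is Kim's
"`|Sel^±_p(E/F_∞)^Γ| ∼ |Sel_p(E/F)| ∏ |ker(g_v)|`" with `∏ |ker g_v|` rendered as `#(A^ε_0/Sel_0)`.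
[cite: BDKim2013, proof of Cor. 3.15 (p. 199)] [cite: GreenbergLNM1716, §4 Lemma 4.3 (p. 103)] -/
theorem natCard_signedSelmerInvariants_mul_natCard_fixedPoints {γ : Field.absoluteGaloisGroup K}
    (hγ : κ.IsTopGenerator γ)
    [Finite (FixedPoints.addSubgroup κ.kerSubgroup (W.geomPrimaryTorsion p))] :
    Nat.card ↥(endInvariants (conjSignedSelmerInfty W κ ε γ - 1)) *
        Nat.card (MulAction.fixedPoints (Field.absoluteGaloisGroup K) (W.geomPrimaryTorsion p)) =
      Nat.card ↥(W.selmerGroupPInfty p) *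
        Nat.card (↥((signedSelmerInfty W κ ε).comap (W.layerToInfty κ 0)) ⧸
          (W.selmerLayer κ 0).addSubgroupOf
            ((signedSelmerInfty W κ ε).comap (W.layerToInfty κ 0))) := by
  rw [← natCard_signedSelmerInfty_inf_layerInvariants_zero_eq W κ ε hγ,
    ← W.natCard_fixedBy_layerSubgroup_zero_eq κ,
    ← W.natCard_ker_layerToInfty_eq_natCard_fixedPoints κ 0, ← W.natCard_selmerLayer_zero_eq κ]
  exact natCard_signedSelmerInvariants_mul_natCard_ker_layerToInfty W κ ε

/-- **`A^ε_0` is finite when `Sel_{p^∞}(E/K)` and `A^ε_0/Sel_0` are**: `#A^ε_0 = #(A^ε_0/Sel_0) · #Sel_0`,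
`Sel_0 ≃ Sel_{p^∞}(E/K)` ("where all the groups occurring are finite", Greenberg p. 103).
[cite: GreenbergLNM1716, §4 Lemma 4.3 (proof, p. 103)] -/
theorem finite_comap_layerToInfty_signedSelmerInfty_of_finite
    (hfin : Finite (W.selmerGroupPInfty p))
    (hg : Finite (↥((signedSelmerInfty W κ ε).comap (W.layerToInfty κ 0)) ⧸
      (W.selmerLayer κ 0).addSubgroupOf ((signedSelmerInfty W κ ε).comap (W.layerToInfty κ 0)))) :
    Finite ↥((signedSelmerInfty W κ ε).comap (W.layerToInfty κ 0)) := by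
  haveI := hg
  haveI : Finite ↥(W.selmerLayer κ 0) := W.finite_selmerLayer_zero κ hfin
  haveI : Finite ↥((W.selmerLayer κ 0).addSubgroupOf
      ((signedSelmerInfty W κ ε).comap (W.layerToInfty κ 0))) :=
    Finite.of_equiv _ (AddSubgroup.addSubgroupOfEquivOfLe
      (selmerLayer_zero_le_comap_layerToInfty_signedSelmerInfty W κ ε)).toEquiv.symm
  refine Nat.finite_of_card_ne_zero ?_
  rw [AddSubgroup.card_eq_card_quotient_mul_card_addSubgroup ((W.selmerLayer κ 0).addSubgroupOf
    ((signedSelmerInfty W κ ε).comap (W.layerToInfty κ 0)))]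
  exact mul_ne_zero Nat.card_pos.ne' Nat.card_pos.ne'

/-- **`A^ε_0 = h_0⁻¹(Sel^ε(E/K_∞))` finite ⟹ `Sel^ε(E/K_∞)^γ` finite.** A class of `H¹(K_∞, E[p^∞])`
fixed by `conj_γ` (`γ` a topological generator) is a restriction from `H¹(K, E[p^∞])` — Greenberg's
Lemma 3.2 "`Coker(h_n) = 0`" at `n = 0` (tree `ZpExtension.mem_range_resOfLe_of_conjH1_eq`, `cd_p ℤ_p = 1`;
Kim: "Since `Γ` has cohomological dimension one, from the Hochschild–Serre spectral sequence it
follows that `H¹(F_Σ/F, A_s) → H¹(F_Σ/F_∞, A_s)^Γ` is surjective", p. 198) — so `Sel^ε(E/K_∞)^γ ↪ A^ε_0`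
by a choice of preimages. [cite: GreenbergLNM1716, §3 Lemma 3.2 (p. 86)] [cite: BDKim2013, proof of Thm. 3.14, (3.2) (p. 198)] -/
theorem finite_endInvariants_conjSignedSelmerInfty_of_finite_comap
    {γ : Field.absoluteGaloisGroup K} (hγ : κ.IsTopGenerator γ)
    (hA : Finite ↥((signedSelmerInfty W κ ε).comap (W.layerToInfty κ 0))) :
    Finite ↥(endInvariants (conjSignedSelmerInfty W κ ε γ - 1)) := by
  have hprim : ∀ m : W.geomPrimaryTorsion p, ∃ k : ℕ, p ^ k • m = 0 := fun m ↦ by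
    obtain ⟨k, hk⟩ := m.2
    exact ⟨k, Subtype.ext (by rw [AddSubgroupClass.coe_nsmul, hk, ZeroMemClass.coe_zero])⟩
  -- every `γ`-fixed class of `Sel^ε_∞` is `h_0 y` for some `y ∈ A^ε_0`
  have hex : ∀ s : ↥(endInvariants (conjSignedSelmerInfty W κ ε γ - 1)),
      ∃ y : ↥((signedSelmerInfty W κ ε).comap (W.layerToInfty κ 0)),
        W.layerToInfty κ 0 (y : W.subgroupH1 p (κ.layerSubgroup 0)) =
          ((s : signedSelmerInfty W κ ε) : W.subgroupH1 p κ.kerSubgroup) := by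
    intro s
    have hfix := (mem_endInvariants_conjSignedSelmerInfty_iff W κ ε γ s.1).mp s.2
    have hfix' : conjH1 κ.kerSubgroup (W.geomPrimaryTorsion p) (γ ^ p ^ 0)
        ((s : signedSelmerInfty W κ ε) : W.subgroupH1 p κ.kerSubgroup) =
          ((s : signedSelmerInfty W κ ε) : W.subgroupH1 p κ.kerSubgroup) := by
      rw [pow_zero, pow_one]; exact hfix
    obtain ⟨y, hy⟩ := ZpExtension.mem_range_resOfLe_of_conjH1_eq κ hγ 0
      (W.continuous_smul_geomPrimaryTorsion p) hprim _ hfix'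
    have hyA : y ∈ (signedSelmerInfty W κ ε).comap (W.layerToInfty κ 0) := by
      rw [AddSubgroup.mem_comap]
      change Literature.NumberTheory.EllipticCurves.resOfLe (W.geomPrimaryTorsion p)
        (κ.kerSubgroup_le_layerSubgroup 0) y ∈ signedSelmerInfty W κ ε
      rw [hy]
      exact (s : signedSelmerInfty W κ ε).2
    exact ⟨⟨y, hyA⟩, hy⟩
  choose f hf using hex
  refine Finite.of_injective f fun s t hst ↦ ?_
  have h := hf s
  rw [hst, hf t] at h
  exact Subtype.ext (Subtype.ext h.symm)

/-! ## §2 Greenberg's Lemma 4.2 ("[2, Lemma 4.2]") × §1 for a Pontryagin-dual datum `D` of `Sel^ε(E/K_∞)` -/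

/-- **Greenberg's Lemma 4.2 for `S = Sel^ε(E/K_∞)`, `X^ε = D.X`** ("From [2, Lemma 4.2] we have
`f^±(0) ∼ |Sel^±_p(E/F_∞)^Γ| / |Sel^±_p(E/F_∞)_Γ|`", Kim p. 200). For any `ℤ_p`-extension `K_∞/K` of a
number field with topological generator `γ`, any sign and any Pontryagin-dual datum `D` with `X^ε`
torsion over `Λ` (it is finitely generated, `SignedSelmerDualData.moduleFinite`) and `char(X^ε) = (f)`:
if `Sel^ε_∞^γ` is finite then `(Sel^ε_∞)_γ = Sel^ε_∞/(γ − 1)` is finite, `ord_T f = 0`, `f(0) ≠ 0`, and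
**`f(0) · #(Sel^ε_∞)_γ = u · #Sel^ε_∞^γ`**, `u ∈ ℤ_pˣ` — the tree's
`IsDualPair.constantCoeff_charGenerator_mul_natCard_endCoinvariants` through `D.isDualPair`.
[cite: GreenbergLNM1716, §4 Lemma 4.2 (p. 102)] [cite: BDKim2013, proof of Cor. 3.15 (p. 200)] -/
theorem constantCoeff_charGenerator_mul_natCard_signedEndCoinvariants
    {γ : Field.absoluteGaloisGroup K} [W.IsElliptic] (D : SignedSelmerDualData W κ γ ε)
    (hγ : κ.IsTopGenerator γ) (hX : Module.IsTorsion (IwasawaAlgebra p) D.X)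
    (f : IwasawaAlgebra p) (hf : D.charIdeal = Ideal.span {f})
    (hfin : Finite ↥(endInvariants (conjSignedSelmerInfty W κ ε γ - 1))) :
    Finite (EndCoinvariants (conjSignedSelmerInfty W κ ε γ - 1)) ∧ f.order = 0 ∧
      PowerSeries.constantCoeff f ≠ 0 ∧
      ∃ u : ℤ_[p]ˣ,
        PowerSeries.constantCoeff f *
            (Nat.card (EndCoinvariants (conjSignedSelmerInfty W κ ε γ - 1)) : ℤ_[p]) =
          u * Nat.card ↥(endInvariants (conjSignedSelmerInfty W κ ε γ - 1)) := by
  haveI := D.moduleFinite hγ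
  have hf' : Module.charIdeal (IwasawaAlgebra p) D.X = Ideal.span {f} := hf
  exact ⟨(D.isDualPair hγ).finite_endCoinvariants_of_finite hX hfin,
    ((D.isDualPair hγ).order_charGenerator_eq_zero_of_finite_endInvariants hX f hf' hfin).1,
    ((D.isDualPair hγ).order_charGenerator_eq_zero_of_finite_endInvariants hX f hf' hfin).2,
    (D.isDualPair hγ).constantCoeff_charGenerator_mul_natCard_endCoinvariants hX f hf' hfin⟩

/-- **Lemma 4.2 × the control column (§1): `f(0) · #(Sel^ε_∞)_γ · #E[p^∞]^{Γ_K} =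
u · #Sel_{p^∞}(E/K) · #(A^ε_0/Sel_0)`**, `u ∈ ℤ_pˣ` — the `±` twin of
`WeierstrassCurve.SelmerDualData.constantCoeff_charGenerator_mul_natCard_coinvariants_mul_natCard_fixedPoints`
(Greenberg's Thm. 4.1 reduced to Lemmas 4.4 + 4.7) — for every number field, `ℤ_p`-extension with
topological generator `γ`, sign, datum `D` with `X^ε` torsion and `char(X^ε) = (f)`, assuming
`E(K_∞)[p^∞]` finite and `Sel^ε_∞^γ` finite; then `(Sel^ε_∞)_γ` is finite and `f(0) ≠ 0`.
[cite: BDKim2013, proof of Cor. 3.15 (pp. 199–200)] [cite: GreenbergLNM1716, §4 Thm. 4.1 (proof, pp. 102–104)] -/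
theorem constantCoeff_charGenerator_mul_natCard_signedEndCoinvariants_mul_natCard_fixedPoints
    {γ : Field.absoluteGaloisGroup K} [W.IsElliptic] (D : SignedSelmerDualData W κ γ ε)
    (hγ : κ.IsTopGenerator γ) (hX : Module.IsTorsion (IwasawaAlgebra p) D.X)
    (f : IwasawaAlgebra p) (hf : D.charIdeal = Ideal.span {f})
    [Finite (FixedPoints.addSubgroup κ.kerSubgroup (W.geomPrimaryTorsion p))]
    (hfin : Finite ↥(endInvariants (conjSignedSelmerInfty W κ ε γ - 1))) :
    Finite (EndCoinvariants (conjSignedSelmerInfty W κ ε γ - 1)) ∧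
      PowerSeries.constantCoeff f ≠ 0 ∧
      ∃ u : ℤ_[p]ˣ,
        PowerSeries.constantCoeff f *
            (Nat.card (EndCoinvariants (conjSignedSelmerInfty W κ ε γ - 1)) : ℤ_[p]) *
            Nat.card (MulAction.fixedPoints (Field.absoluteGaloisGroup K) (W.geomPrimaryTorsion p)) =
          u * Nat.card ↥(W.selmerGroupPInfty p) *
            Nat.card (↥((signedSelmerInfty W κ ε).comap (W.layerToInfty κ 0)) ⧸
              (W.selmerLayer κ 0).addSubgroupOf
                ((signedSelmerInfty W κ ε).comap (W.layerToInfty κ 0))) := by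
  obtain ⟨hH1, -, hf0, u, hu⟩ :=
    constantCoeff_charGenerator_mul_natCard_signedEndCoinvariants W κ ε D hγ hX f hf hfin
  refine ⟨hH1, hf0, u, ?_⟩
  have h58 := natCard_signedSelmerInvariants_mul_natCard_fixedPoints W κ ε hγ
  have h58' : (Nat.card ↥(endInvariants (conjSignedSelmerInfty W κ ε γ - 1)) : ℤ_[p]) *
      Nat.card (MulAction.fixedPoints (Field.absoluteGaloisGroup K) (W.geomPrimaryTorsion p)) =
        (Nat.card ↥(W.selmerGroupPInfty p) : ℤ_[p]) *
          Nat.card (↥((signedSelmerInfty W κ ε).comap (W.layerToInfty κ 0)) ⧸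
            (W.selmerLayer κ 0).addSubgroupOf
              ((signedSelmerInfty W κ ε).comap (W.layerToInfty κ 0))) := by
    exact_mod_cast h58
  rw [hu, mul_assoc, h58', mul_assoc]

/-- **The same from finiteness of `Sel_{p^∞}(E/K)` and of `A^ε_0/Sel_0`** (which give `A^ε_0` finite,
`finite_comap_layerToInfty_signedSelmerInfty_of_finite`, hence `Sel^ε_∞^γ` finite by Greenberg's
Lemma 3.2, `finite_endInvariants_conjSignedSelmerInfty_of_finite_comap`): then `Sel^ε_∞^γ` and
`(Sel^ε_∞)_γ` are finite, `f(0) ≠ 0`, and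
`f(0) · #(Sel^ε_∞)_γ · #E[p^∞]^{Γ_K} = u · #Sel_{p^∞}(E/K) · #(A^ε_0/Sel_0)`.
[cite: BDKim2013, proof of Cor. 3.15 (pp. 199–200)] [cite: GreenbergLNM1716, §4 Thm. 4.1 (proof, pp. 102–104)] -/
theorem constantCoeff_charGenerator_mul_natCard_signedEndCoinvariants_of_finite
    {γ : Field.absoluteGaloisGroup K} [W.IsElliptic] (D : SignedSelmerDualData W κ γ ε)
    (hγ : κ.IsTopGenerator γ) (hX : Module.IsTorsion (IwasawaAlgebra p) D.X)
    (f : IwasawaAlgebra p) (hf : D.charIdeal = Ideal.span {f})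
    [Finite (FixedPoints.addSubgroup κ.kerSubgroup (W.geomPrimaryTorsion p))]
    (hSelfin : Finite (W.selmerGroupPInfty p))
    (hg : Finite (↥((signedSelmerInfty W κ ε).comap (W.layerToInfty κ 0)) ⧸
      (W.selmerLayer κ 0).addSubgroupOf ((signedSelmerInfty W κ ε).comap (W.layerToInfty κ 0)))) :
    Finite ↥(endInvariants (conjSignedSelmerInfty W κ ε γ - 1)) ∧
      Finite (EndCoinvariants (conjSignedSelmerInfty W κ ε γ - 1)) ∧
      PowerSeries.constantCoeff f ≠ 0 ∧
      ∃ u : ℤ_[p]ˣ,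
        PowerSeries.constantCoeff f *
            (Nat.card (EndCoinvariants (conjSignedSelmerInfty W κ ε γ - 1)) : ℤ_[p]) *
            Nat.card (MulAction.fixedPoints (Field.absoluteGaloisGroup K) (W.geomPrimaryTorsion p)) =
          u * Nat.card ↥(W.selmerGroupPInfty p) *
            Nat.card (↥((signedSelmerInfty W κ ε).comap (W.layerToInfty κ 0)) ⧸
              (W.selmerLayer κ 0).addSubgroupOf
                ((signedSelmerInfty W κ ε).comap (W.layerToInfty κ 0))) := by
  have hA := finite_comap_layerToInfty_signedSelmerInfty_of_finite W κ ε hSelfin hg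
  have hfin : Finite ↥(endInvariants (conjSignedSelmerInfty W κ ε γ - 1)) :=
    finite_endInvariants_conjSignedSelmerInfty_of_finite_comap W κ ε hγ hA
  exact ⟨hfin, constantCoeff_charGenerator_mul_natCard_signedEndCoinvariants_mul_natCard_fixedPoints
    W κ ε D hγ hX f hf hfin⟩

end General

/-! ## §3 Over `ℚ` at a supersingular `p ≠ 2`, in the binder shape of `cor315_signedCharValue_rankZero` -/

/-- **Kim 2013, proof of Cor. 3.15 up to its two non-kernel inputs, over `ℚ`.** For `W/ℚ` elliptic
and globally minimal, `p ≠ 2` of good reduction with `a_p = 0` (so supersingular), any `ℤ_p`-extension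
`κ` with topological generator `γ` (cyclotomicity is not used), any sign `ε`, any Pontryagin-dual datum
`D` of `Sel^ε(E/ℚ_∞)` with `X^ε = D.X` torsion and `char(X^ε) = (f)`: IF `Sel_{p^∞}(E/ℚ)` and the
cokernel `A^ε_0/Sel_0` of `Sel_p(E/ℚ) → Sel^±_p(E/ℚ_∞)^Γ` are finite, THEN `Sel^ε_∞^γ`, `(Sel^ε_∞)_γ`
are finite, `f(0) ≠ 0` and **`f(0) · #(Sel^ε_∞)_γ = u · #Sel_{p^∞}(E/ℚ) · #(A^ε_0/Sel_0)`** for a unit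
`u ∈ ℤ_pˣ` — §2 with `#E(ℚ)_p = #E[p^∞]^{Γ_ℚ} = 1` (a rational point of order `p` at a good `p ≥ 3`
forces `a_p ≡ 1 (mod p)`; tree `Sprung2024.natCard_fixedPoints_geomPrimaryTorsion_eq_one_of_supersingular`;
Kim's Prop. 3.2 "`E(F_{n,v})` is `p`-torsion-free") and `E(ℚ_∞)[p^∞]` finite
(`finite_fixedPoints_kerSubgroup_geomPrimaryTorsion_rat`). Printed: "`|Sel^±_p(E/F_∞)^Γ| ∼
|Sel_p(E/F)| ∏_{v∈Σ} |ker(g_v)|` … `f^±(0) ∼ |Sel^±_p(E/F_∞)^Γ| / |Sel^±_p(E/F_∞)_Γ|`". With the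
remaining printed inputs (`#(A^ε_0/Sel_0) = p^{ord_p ∏ c_v}` and Thm. 3.14 `#(Sel^ε_∞)_Γ = 1`,
vendored separately) this is `f(0) = u · p^{ord_p ∏ c_v} · #Sel_{p^∞}(E/ℚ)`, the body of `cor315_…`.
[cite: BDKim2013, proof of Cor. 3.15 (pp. 199–200)] [cite: GreenbergLNM1716, §4 Lemmas 4.2–4.3 (pp. 102–103)] -/
theorem constantCoeff_charGenerator_mul_natCard_signedEndCoinvariants_rat
    (W : WeierstrassCurve ℚ) [W.IsElliptic] [W.IsGloballyMinimal] (p : ℕ) [Fact p.Prime]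
    (hp2 : p ≠ 2) (hgood : W.HasGoodReductionAtPrime p) (hap : W.frobeniusTrace p = 0)
    (κ : ZpExtension ℚ p) {γ : Field.absoluteGaloisGroup ℚ} (hγ : κ.IsTopGenerator γ) (ε : ℤˣ)
    (D : SignedSelmerDualData W κ γ ε) (hX : Module.IsTorsion (IwasawaAlgebra p) D.X)
    (f : IwasawaAlgebra p) (hf : D.charIdeal = Ideal.span {f})
    (hfin : Finite (W.selmerGroupPInfty p))
    (hkerg : Finite (↥((signedSelmerInfty W κ ε).comap (W.layerToInfty κ 0)) ⧸
      (W.selmerLayer κ 0).addSubgroupOf ((signedSelmerInfty W κ ε).comap (W.layerToInfty κ 0)))) :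
    Finite ↥(endInvariants (conjSignedSelmerInfty W κ ε γ - 1)) ∧
      Finite (EndCoinvariants (conjSignedSelmerInfty W κ ε γ - 1)) ∧
      PowerSeries.constantCoeff f ≠ 0 ∧
      ∃ u : ℤ_[p]ˣ,
        PowerSeries.constantCoeff f *
            (Nat.card (EndCoinvariants (conjSignedSelmerInfty W κ ε γ - 1)) : ℤ_[p]) =
          u * Nat.card ↥(W.selmerGroupPInfty p) *
            Nat.card (↥((signedSelmerInfty W κ ε).comap (W.layerToInfty κ 0)) ⧸
              (W.selmerLayer κ 0).addSubgroupOf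
                ((signedSelmerInfty W κ ε).comap (W.layerToInfty κ 0))) := by
  -- `E(ℚ_∞)[p^∞]` is finite
  haveI := W.finite_fixedPoints_kerSubgroup_geomPrimaryTorsion_rat κ (p := p)
  have hap' : (p : ℤ) ∣ W.frobeniusTrace p := by rw [hap]; exact dvd_zero _
  obtain ⟨h0, h1, hf0, u, hu⟩ :=
    constantCoeff_charGenerator_mul_natCard_signedEndCoinvariants_of_finite W κ ε D hγ hX f hf hfin hkerg
  refine ⟨h0, h1, hf0, u, ?_⟩
  rw [Sprung2024.natCard_fixedPoints_geomPrimaryTorsion_eq_one_of_supersingular W p hp2 hgood hap',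
    Nat.cast_one, mul_one] at hu
  exact hu

/-- **`Sel_{p^∞}(E/ℚ)` and `A^ε_0/Sel_0` finite ⟹ `X^ε(E/ℚ_∞)` is `Λ`-torsion** (every `ℤ_p`-extension of a
number field with topological generator, every sign and datum): `A^ε_0` is finite (§1), so `Sel^ε_∞^γ` is
finite (Greenberg's Lemma 3.2), so `X^ε` is torsion (`SignedSelmerDualData.isTorsion_of_finite_endInvariants`,
Greenberg's Thm. 1.4 argument) — the first sentence of Kim's proof of Cor. 3.15 ("our assumption implies
that `Sel^±_p(E/F_∞)` is `Λ`-cotorsion because the control theorem holds true for the plus/minus Selmer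
groups", p. 199) with the control theorem's finiteness of the cokernel displayed as the hypothesis `hg`.
[cite: BDKim2013, proof of Cor. 3.15 (p. 199)] [cite: GreenbergLNM1716, §1 Thm. 1.4 (proof, p. 61)] -/
theorem isTorsion_of_finite_selmerGroup_of_finite_kerG {K : Type u} [Field K] [NumberField K]
    (W : WeierstrassCurve K) [W.IsElliptic] {p : ℕ} [Fact p.Prime] (κ : ZpExtension K p) (ε : ℤˣ)
    {γ : Field.absoluteGaloisGroup K} (hγ : κ.IsTopGenerator γ) (D : SignedSelmerDualData W κ γ ε)
    (hfin : Finite (W.selmerGroupPInfty p))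
    (hg : Finite (↥((signedSelmerInfty W κ ε).comap (W.layerToInfty κ 0)) ⧸
      (W.selmerLayer κ 0).addSubgroupOf ((signedSelmerInfty W κ ε).comap (W.layerToInfty κ 0)))) :
    Module.IsTorsion (IwasawaAlgebra p) D.X :=
  D.isTorsion_of_finite_endInvariants hγ
    (finite_endInvariants_conjSignedSelmerInfty_of_finite_comap W κ ε hγ
      (finite_comap_layerToInfty_signedSelmerInfty_of_finite W κ ε hfin hg))

end Literature.NumberTheory.EllipticCurves.BDKim2013

end
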